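import Literature.MathematicalPhysics.QuantumFieldTheory.Balaban1983to89.B7Prop3GeneralAnalytic

/-!
# `Balaban1983to89.B7Prop6General` — T. Bałaban, *Averaging operations for lattice gauge theories*, Commun. Math. Phys.
**98** (1985) 17–51 [Balaban1985Averaging], Sect. E, **Proposition 6 (159)–(164) pp. 42–43 AT A GENERAL (curved)
BACKGROUND `U₀`, UNIFORMLY IN `k`** — kernel form over the concrete model of the `B7Eq92Concrete` lineage: the frame
estimates (162)–(163) for the covariant block frames and the bound (164) `|\overline{U′U₀}ᵏ(Ū₀ᵏ)⁻¹ − 1| < O(1)α₁` with the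
explicit witness `O(1) = 200(d+1)`, from the displayed input (161)

statement-level skeleton of published theorems with citation tags; proofs where landed; nothing here is a claim about the Yang–Mills mass gap

PDF held: `paper:balaban1985-cmp98-averaging` (journal page = PDF page + 16); renders `…/1985-cmp98-averaging-p026-x2.png`,
`p027-x2.png` (pp. 42–43), read as images by the unit.

CITATION HEADER (lean-in-tree rule).  Cell `lit-balaban` (HOME `run/shared/lean/pub/lit-balaban/`), unit `lit-balaban-r04`
(reader/typer of block B7, gen 3), an ANNOUNCED reader build (HOME/STATUS.md `TAKING B7.Prop6 / B7.Eq159 @gen →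
B7Prop6General.lean`, 2026-08-21) — a KERNEL PIECE for SKELETON rows `B7.Prop6` (decl of record `B7.Prop6Printed`, abstract
carrier; flat kernel `B7Prop6Flat.prop6_flat`) and `B7.Eq159` ((159)–(163); the identity (159) at a general background is
`B7Eq92Concrete.avgIter_mul_eq_gaugeAct`, the flat estimates are `B7Prop6Flat.ineq161/162/163`).  Nothing of the abstract
carrier `B7.lean` is instantiated.

PRINT (p. 42–43, verbatim; the full passage is quoted in the module docstring of `B7Prop6Flat`).  p. 42: "We will prove that
`Ūᵏ = \overline{U′U₀}ᵏ` is an analytic function of `A′` and `Ūᵏ(Ūᵏ₀)⁻¹` is close to 1; the difference may be estimated by a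
constant proportional to `α₁`. We have `Ūᵏ_b(Ūᵏ₀)_b⁻¹ = (\overline{U′U₀})ᵏ_b(Ūᵏ₀)_b⁻¹ = (Ũ′)ᵏ_b = v_k(b₋)(U̿′ᵏ)_bR̄ᵏ_{0,b}v_k⁻¹(b₊),
b ⊂ Ω^{(k)}`, (159) where `v_k(x) = (\overline{R_{0,x}U′})(\overline{R̄_{0,x}U̿′})·…·(\overline{R̄^{k−1}_{0,x}U̿′^{k−1}})`,
`x ∈ Ω^{(k)}`. (160) From Proposition 4, and especially from (131), we get `|(1/i) log U̿′ʲ| = |Q_j(U₀, ηA′)| < 2α₁Lʲη`, (161)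
hence `|(1/i) log(\overline{R̄ʲ_{0,x}U̿′ʲ})| = |Σ_{x_j∈B(x)} L^{−d}(1/i) log(R̄ʲ_{0,x}U̿′ʲ)(Γ_{x,x_j})| < 8α₁dL^{j+1}η e^{2α₁dL^{j+1}η}
< O(1)α₁L^{j+1}η, j = 0, 1, …, k − 1` (162) and `|v_k(x) − 1| < O(1)α₁ Σ_{j=0}^{k−1} L^{j+1}η ≦ O(1)α₁` (163) for `α₁`
sufficiently small."  p. 43: "**Proposition 6.** If `U₀` satisfies (52), then `\overline{U′U₀}ᵏ` is an analytic function of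
`A′ = (1/(iη)) log U′` for `A′` with values in the complexified algebra, and satisfying `|A′| < α₁`. Moreover, we have a bound
`|\overline{U′U₀}ᵏ(Ūᵏ₀)⁻¹ − 1| < O(1)α₁`. (164)  Of course, we assume that `α₀, α₁` are sufficiently small."

WHAT THIS FILE PROVES (kernel, no `sorry`, standard axioms; all constants explicit).  Setting of `B7Eq92Concrete` (`𝔸` a
complete normed `ℂ`-algebra with `‖1‖ = 1`; `U₀, U₁ : ℤᵈ → (Fin d → 𝔸ˣ)`, `U = U₁U₀` (print `U′ = U₁ = e^{iηA′}`); every level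
`Ω^{(j)}` read on `ℤᵈ` by `rescale`; the `k`-fold averages `avgIter` (43), the covariant double-bar iterates `U̿′ʲ =
dbavgCovIter L U₀ U₁ j` (90)/(91), the covariant block frames `\overline{R̄ʲ_{0,y}U̿′ʲ} = wframe L (Ū₀ʲ) (U̿′ʲ) y = exp Fcov`
(82)/(85), the accumulated frame `v_k = vcov L U₀ U₁ k` (97)/(160); `b` plays `ηα₁`, `Lᵏb` plays `α₁` with `Lᵏη = 1`).
DISPLAYED HYPOTHESES: the averaged backgrounds `Ū₀ʲ`, `j ≤ k`, have values in `U1 = {‖u‖ ≤ 1, ‖u⁻¹‖ ≤ 1}` (discharged from (52)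
for `G`-valued `U₀`, `G` average-closed, in `prop6_general_of52` by `B7Prop2Explicit.avgIter_mem`), and **(161) in exp-form**:
`U̿′ʲ = e^{Q_j}` bondwise with `‖Q_j‖ ≤ 2Lʲb` for all `j ≤ k` (at `U₀ = 1`: `B7Prop6Flat.ineq161` = `B7Prop4Flat.prop4_flat_induction`;
at a general background it is Proposition 4 (131), in the tree `B7Prop4GeneralLevels.prop4_general_of_prop3` under its displayed
Prop.-3 binders).
* §1 `frameFacG`, `val_vcov_eq_oprod` — (160) verbatim: `v_k(z) = ∏_{j<k} \overline{R̄ʲ_{0,·}U̿′ʲ}(L^{k−j}z)` as an ordered product.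
* §2 **`ineq162_general`** — (162): `‖Fcov‖ ≤ 8d·L^{j+1}b`, `‖frame − 1‖, ‖frame⁻¹ − 1‖ ≤ 16d·L^{j+1}b` for `j < k`, under
  `128d·Lᵏb ≤ 1` (the twisted tree holonomies of `e^{Q_j}` at a `U1` background: `B7Prop3GeneralAnalytic.norm_tHol_expCfg_sub_one_le_of_length`,
  `norm_Fcov_le_of_tHol`; print's factor `e^{2α₁dL^{j+1}η} ≥ 1` not needed).
* §3 **`ineq163_general`** — (163): `‖v_k(z) − 1‖ ≤ e^{32d·Lᵏb} − 1 ≤ 64d·Lᵏb`, `‖v_k(z)⁻¹ − 1‖ ≤ 128d·Lᵏb`, UNIFORMLY IN `k`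
  (`B7Prop6Bound.ineq163_explicit` on the ordered product of §1), under the single threshold `8C₁(d)Lᵏb ≤ 1` of `B7Prop6Flat`.
* §4 **`prop6_general`** — (159) & (164): `Ūᵏ(c)(Ū₀ᵏ(c))⁻¹ = v_k(c₋)·e^{Q_k(c)}·R(Ū₀ᵏ(c))(v_k(c₊)⁻¹)` and
  **`‖Ūᵏ(c)(Ū₀ᵏ(c))⁻¹ − 1‖ ≤ 200(d+1)·Lᵏb`** at every bond `c` of `Ω^{(k)}` — print's `O(1)` witnessed by `200(d+1)`, independent
  of `k`, `L`, `b` (the same witness as `B7Prop6Flat.prop6_flat`); **`prop6_general_of52`** — the `U1` level hypothesis discharged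
  from (52) (`B7Prop2Explicit.avgIter_mem`), (161) kept displayed.
READINGS (recorded; none is an objection to print).  (a) `U1`-valued backgrounds and the BANACH reading of `|·|` as in the lineage
(print: `G ⊂ U(N)`, `R(·)` an isometry — here `‖R(u)X − 1‖ ≤ ‖X − 1‖`, `B7Prop1Explicit.norm_units_conj_sub_one_le`).  (b) (161) is
an INPUT here (print derives it from Prop. 4): this file is "Prop. 6 from (161)", k-uniform; the analyticity clause of Prop. 6 at
a general background is NOT treated (flat: `B7Prop6Flat.prop6_flat_analyticAt`; @gen for the one step: `B7Prop3GeneralAnalytic`).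
(c) SMALLNESS: the single threshold `8C₁(d)·Lᵏb ≤ 1` (`C₁(d) = 1256(d+1)²`, `B7Prop3Flat.C1`; `Lᵏb` plays `α₁`), as in
`B7Prop6Flat`.  (d) LATTICE conventions of `B7Eq92Concrete` (all of `ℤᵈ`, blocks `Lz + [0,L)ᵈ`, tree contours
`B7Prop1Explicit.treeWord`; `≤` for `<`).  NOT CLAIMED: (161) at a general background (Prop. 4 @gen); the analyticity clause;
print's unstated `O(1)` beyond the witness `200(d+1)`.
DECLARATIONS: 1 definition (`frameFacG`), the rest theorems; imports `B7Prop3GeneralAnalytic` (hence `B7Eq92Concrete`,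
`B7Prop6Flat`, `B7Prop6Bound`); REUSED BY NAME: `B7Eq92Concrete.vcov, vcov_succ, wframe, Fcov, dbavgCovIter, tHol,
val_avgIter_mul_eq`, `B7Prop3GeneralAnalytic.norm_tHol_expCfg_sub_one_le_of_length, norm_Fcov_le_of_tHol`,
`B7Prop6Flat.arith164, norm_mul_mul_sub_one_le, small_of_threshold, norm_units_inv_sub_one_le, oprod_congr`,
`B7Prop6Bound.oprod, ineq163_explicit`, `B7Prop3Flat.expCfg, C1`, `B7Prop2Explicit.avgIter, avgIter_mem, AvgClosed, pdev, C0,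
c2'`, `B7Prop1Explicit.norm_units_conj_sub_one_le, norm_exp_sub_one_le_of_norm_le, length_treeWord, l1_boxVec_le, U1, expUnit`.
Unit `lit-balaban-r04` (gen 3), 2026-08-21.

[cite: Balaban1985Averaging, Proposition 6 (164) p.43, (159)–(163) p.42, (97) p.32, (82)–(85) pp.30–31, (52) p.26]
-/

noncomputable section

open NormedSpace Finset

namespace Literature.MathematicalPhysics.QuantumFieldTheory.Balaban1983to89.B7Prop6General

open B7Prop1Explicit B7Prop2Explicit B7Prop3Flat MatrixLog B7Eq92Concrete B7Prop3GeneralAnalytic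
open B7Prop6Flat (arith164 norm_mul_mul_sub_one_le small_of_threshold norm_units_inv_sub_one_le oprod_congr)
open B7Prop6Bound (oprod ineq163_explicit)

-- `Site` alone would resolve to the torus sites of `Setup.lean`; re-export the `ℤ^d` sites of `B7Prop1Explicit`.
export B7Prop1Explicit (Site)

variable {d : ℕ}

variable {𝔸 : Type*} [NormedRing 𝔸] [NormedAlgebra ℂ 𝔸] [CompleteSpace 𝔸] [NormOneClass 𝔸]

/-! ## §1 (160) at a general background: the accumulated frame as an ordered product -/

omit [NormOneClass 𝔸] in
/-- The `j`-th factor of (160) for the site `x = Lᵏz ∈ Ω^{(k)}`, read at level `j` (where `x` is the site `L^{k−j}z` of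
`Ω^{(j)} ≅ ℤᵈ`): `\overline{R̄ʲ_{0,x}U̿′ʲ}` = the covariant block frame (82)/(85) of `U̿′ʲ` at the averaged background `Ū₀ʲ`
(`B7Eq92Concrete.wframe`).  At `U₀ = 1`: `B7Prop6Flat.frameFac`. [cite: Balaban1985Averaging, (160) p.42, (85) p.31] -/
def frameFacG (L : ℕ) (U₀ U₁ : Site d → Fin d → 𝔸ˣ) (k : ℕ) (z : Site d) (j : ℕ) : 𝔸ˣ :=
  wframe L (avgIter L U₀ j) (dbavgCovIter L U₀ U₁ j) (((L : ℤ) ^ (k - j)) • z)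

omit [NormOneClass 𝔸] in
/-- **(160) verbatim at a general background**: `v_k(z) = \overline{R_{0,·}U′}(Lᵏz)·\overline{R̄_{0,·}U̿′}(L^{k−1}z)·…·
\overline{R̄^{k−1}_{0,·}U̿′^{k−1}}(Lz)` — the recursive `B7Eq92Concrete.vcov` ((97): `v_{j+1}(z) = v_j(Lz)·\overline{R̄ʲ_{0,Lz}U̿′ʲ}`)
is the ordered product (`B7Prop6Bound.oprod`, leftmost factor `j = 0`) of the `k` covariant block frames.  At `U₀ = 1`:
`B7Prop6Flat.val_vprod_eq_oprod`. [cite: Balaban1985Averaging, (160) p.42, (97) p.32] -/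
theorem val_vcov_eq_oprod (L : ℕ) (U₀ U₁ : Site d → Fin d → 𝔸ˣ) : ∀ (k : ℕ) (z : Site d),
    (vcov L U₀ U₁ k z : 𝔸) = oprod (fun j => (frameFacG L U₀ U₁ k z j : 𝔸)) k
  | 0, z => by simp [B7Prop6Bound.oprod]
  | k + 1, z => by
    rw [vcov_succ, Units.val_mul, val_vcov_eq_oprod L U₀ U₁ k ((L : ℤ) • z)]
    simp only [B7Prop6Bound.oprod]
    congr 1
    · refine oprod_congr k fun j hj => ?_
      show ((wframe L (avgIter L U₀ j) (dbavgCovIter L U₀ U₁ j) (((L : ℤ) ^ (k - j)) • ((L : ℤ) • z)) : 𝔸ˣ) : 𝔸)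
          = ((wframe L (avgIter L U₀ j) (dbavgCovIter L U₀ U₁ j) (((L : ℤ) ^ (k + 1 - j)) • z) : 𝔸ˣ) : 𝔸)
      rw [smul_smul, ← pow_succ, ← Nat.sub_add_comm (le_of_lt hj)]
    · simp [frameFacG]

/-! ## §2 (162) at a general background: the covariant block frames of `U̿′ʲ = e^{Q_j}` -/

/-- **(162) AT A GENERAL BACKGROUND** — "hence `|(1/i) log(\overline{R̄ʲ_{0,x}U̿′ʲ})| = |Σ_{x_j∈B(x)} L^{−d}(1/i)
log(R̄ʲ_{0,x}U̿′ʲ)(Γ_{x,x_j})| < 8α₁dL^{j+1}η e^{2α₁dL^{j+1}η} < O(1)α₁L^{j+1}η, j = 0, 1, …, k − 1`": for the averaged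
background `Ū₀ʲ` with values in `U1` and `U̿′ʲ = e^{Q_j}` with `‖Q_j‖ ≤ 2Lʲb` ((161)), `128d·Lᵏb ≤ 1`, `j < k`, at every
block corner `y`: the frame exponent `F(y) = Σ_{x∈B(y)} L^{−d} log(R̄ʲ_{0,y}U̿′ʲ)(Γ_{y,x})` (`B7Eq92Concrete.Fcov`) and the frame
`\overline{R̄ʲ_{0,y}U̿′ʲ} = e^{F(y)}` (`wframe`) satisfy `‖F(y)‖ ≤ 8d·L^{j+1}b`, `‖frame − 1‖ ≤ 16d·L^{j+1}b`, `‖frame⁻¹ − 1‖ ≤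
16d·L^{j+1}b` — each twisted tree holonomy `(R̄ʲ_{0,y}e^{Q_j})(Γ_{y,x})` (`|Γ_{y,x}| ≤ dL` bonds, rotations in `U1`) is within
`2θ` of `1`, `θ = 2d·L^{j+1}b ≤ 1/64` (`B7Prop3GeneralAnalytic.norm_tHol_expCfg_sub_one_le_of_length`), whence
`‖F‖ ≤ 4θ` (`norm_Fcov_le_of_tHol`) and `‖e^{±F} − 1‖ ≤ 2‖F‖`.  At `U₀ = 1`: `B7Prop6Flat.ineq162`.
[cite: Balaban1985Averaging, (162) p.42, (82)–(85) pp.30–31, (58) p.27] -/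
theorem ineq162_general {L : ℕ} (hL : 1 ≤ L) {U₀ U₁ : Site d → Fin d → 𝔸ˣ} {k : ℕ} {b : ℝ} (hb : 0 ≤ b)
    (hV : ∀ j ≤ k, ∀ (x : Site d) (κ : Fin d), avgIter L U₀ j x κ ∈ U1 𝔸)
    (Q : ℕ → Site d → Fin d → 𝔸) (hQ : ∀ j ≤ k, dbavgCovIter L U₀ U₁ j = expCfg (Q j))
    (hQb : ∀ j ≤ k, ∀ (z : Site d) (κ : Fin d), ‖Q j z κ‖ ≤ 2 * ((L : ℝ) ^ j * b))
    (hsm : 128 * d * ((L : ℝ) ^ k * b) ≤ 1) {j : ℕ} (hj : j < k) (y : Site d) :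
    ‖Fcov L (avgIter L U₀ j) (dbavgCovIter L U₀ U₁ j) y‖ ≤ 8 * d * ((L : ℝ) ^ (j + 1) * b) ∧
    ‖((wframe L (avgIter L U₀ j) (dbavgCovIter L U₀ U₁ j) y : 𝔸ˣ) : 𝔸) - 1‖ ≤ 16 * d * ((L : ℝ) ^ (j + 1) * b) ∧
    ‖(((wframe L (avgIter L U₀ j) (dbavgCovIter L U₀ U₁ j) y)⁻¹ : 𝔸ˣ) : 𝔸) - 1‖ ≤ 16 * d * ((L : ℝ) ^ (j + 1) * b) := by
  have hL1r : (1 : ℝ) ≤ L := by exact_mod_cast hL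
  have hd0 : (0 : ℝ) ≤ d := Nat.cast_nonneg d
  rw [hQ j hj.le]
  set a : ℝ := 2 * ((L : ℝ) ^ j * b) with ha_def
  have ha : 0 ≤ a := by positivity
  set θ : ℝ := 2 * d * ((L : ℝ) ^ (j + 1) * b) with hθ_def
  have hθ0 : 0 ≤ θ := by positivity
  have hna : ((d * L : ℕ) : ℝ) * a = θ := by rw [hθ_def, ha_def, pow_succ]; push_cast; ring
  have ht_mono : (L : ℝ) ^ (j + 1) * b ≤ (L : ℝ) ^ k * b :=
    mul_le_mul_of_nonneg_right (pow_le_pow_right₀ hL1r hj) hb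
  have hθ1 : θ ≤ 1 / 64 := by
    rw [hθ_def]
    have h1 : 2 * (d : ℝ) * ((L : ℝ) ^ (j + 1) * b) ≤ 2 * d * ((L : ℝ) ^ k * b) :=
      mul_le_mul_of_nonneg_left ht_mono (by positivity)
    linarith
  -- every twisted tree holonomy of `e^{Q_j}` over the block is within `2θ` of `1`
  have hτ : ∀ r : Fin d → Fin L,
      ‖((tHol (avgIter L U₀ j) (expCfg (Q j)) y (treeWord (boxVec L r)) : 𝔸ˣ) : 𝔸) - 1‖ ≤ 2 * θ := fun r =>
    norm_tHol_expCfg_sub_one_le_of_length (hV j hj.le) (Q j) ha (hQb j hj.le) (n := d * L) hna.le hθ0 hθ1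
      (by rw [length_treeWord]; exact l1_boxVec_le L r) y
  have hF : ‖Fcov L (avgIter L U₀ j) (expCfg (Q j)) y‖ ≤ 4 * θ := by
    have h := norm_Fcov_le_of_tHol hL (avgIter L U₀ j) (expCfg (Q j)) y hτ (by linarith)
    linarith
  have hF1 : ‖Fcov L (avgIter L U₀ j) (expCfg (Q j)) y‖ ≤ 1 := hF.trans (by linarith)
  -- `‖e^{±F} − 1‖ ≤ 2‖F‖`
  have hexp : ∀ F : 𝔸, ‖F‖ ≤ 4 * θ → ‖exp F - 1‖ ≤ 8 * θ := by
    intro F hFθ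
    have h1 := (norm_exp_sub_one_le_of_norm_le (le_refl ‖F‖)).1
    have hF1' : ‖F‖ ≤ 1 := hFθ.trans (by linarith)
    have h2 := Real.abs_exp_sub_one_le (x := ‖F‖) (by rwa [abs_of_nonneg (norm_nonneg _)])
    rw [abs_of_nonneg (norm_nonneg F)] at h2
    have h3 : Real.exp ‖F‖ - 1 ≤ 2 * ‖F‖ := (le_abs_self _).trans h2
    linarith
  refine ⟨?_, ?_, ?_⟩
  · calc _ ≤ 4 * θ := hF
      _ = _ := by rw [hθ_def]; ring
  · rw [wframe, val_expUnit]
    calc _ ≤ 8 * θ := hexp _ hF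
      _ = _ := by rw [hθ_def]; ring
  · rw [wframe, val_inv_expUnit, val_expUnit]
    calc _ ≤ 8 * θ := hexp _ (by rw [norm_neg]; exact hF)
      _ = _ := by rw [hθ_def]; ring

/-! ## §3 (163) at a general background, uniformly in `k` -/

/-- **(163) AT A GENERAL BACKGROUND, with EXPLICIT `O(1)`, uniformly in `k`** — "`|v_k(x) − 1| < O(1)α₁ Σ_{j=0}^{k−1} L^{j+1}η
≦ O(1)α₁` for `α₁` sufficiently small": for `L ≥ 2`, level backgrounds `Ū₀ʲ ∈ U1` (`j ≤ k`), (161) in exp-form, and the single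
threshold `8C₁(d)Lᵏb ≤ 1` (so `Lᵏb` plays `α₁`, `Lᵏη = 1`), at every site `z` of `Ω^{(k)}`: `‖v_k(z) − 1‖ ≤ exp(32d·Lᵏb) − 1 ≤
32d·Lᵏb·exp(32d·Lᵏb)`, hence `‖v_k(z) − 1‖ ≤ 64d·Lᵏb` and `‖v_k(z)⁻¹ − 1‖ ≤ 128d·Lᵏb` (`v_k = B7Eq92Concrete.vcov L U₀ U₁ k`) —
`B7Prop6Bound.ineq163_explicit` BY NAME on the ordered product (160) (`val_vcov_eq_oprod`) with the per-factor bound (162)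
`16d·α₁·L^{j+1}η`.  At `U₀ = 1`: `B7Prop6Flat.ineq163` (same constants). [cite: Balaban1985Averaging, (163) p.42] -/
theorem ineq163_general {L : ℕ} (hL : 2 ≤ L) {U₀ U₁ : Site d → Fin d → 𝔸ˣ} {k : ℕ} {b : ℝ} (hb : 0 ≤ b)
    (hV : ∀ j ≤ k, ∀ (x : Site d) (κ : Fin d), avgIter L U₀ j x κ ∈ U1 𝔸)
    (Q : ℕ → Site d → Fin d → 𝔸) (hQ : ∀ j ≤ k, dbavgCovIter L U₀ U₁ j = expCfg (Q j))
    (hQb : ∀ j ≤ k, ∀ (z : Site d) (κ : Fin d), ‖Q j z κ‖ ≤ 2 * ((L : ℝ) ^ j * b))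
    (hk : 8 * C1 d * ((L : ℝ) ^ k * b) ≤ 1) (z : Site d) :
    ‖(vcov L U₀ U₁ k z : 𝔸) - 1‖ ≤ Real.exp (32 * d * ((L : ℝ) ^ k * b)) - 1 ∧
    Real.exp (32 * d * ((L : ℝ) ^ k * b)) - 1
      ≤ 32 * d * ((L : ℝ) ^ k * b) * Real.exp (32 * d * ((L : ℝ) ^ k * b)) ∧
    ‖(vcov L U₀ U₁ k z : 𝔸) - 1‖ ≤ 64 * d * ((L : ℝ) ^ k * b) ∧
    ‖(((vcov L U₀ U₁ k z)⁻¹ : 𝔸ˣ) : 𝔸) - 1‖ ≤ 128 * d * ((L : ℝ) ^ k * b) := by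
  have hL1 : 1 ≤ L := le_trans (by norm_num) hL
  have hLr : (2 : ℝ) ≤ L := by exact_mod_cast hL
  have hL0 : (0 : ℝ) < L := by linarith
  have hd0 : (0 : ℝ) ≤ d := Nat.cast_nonneg d
  set t : ℝ := (L : ℝ) ^ k * b with ht_def
  have ht0 : 0 ≤ t := by positivity
  have hsmall := small_of_threshold (d := d) ht0 hk
  have hLk : (L : ℝ) ^ k ≠ 0 := pow_ne_zero _ hL0.ne'
  have hsm : 128 * d * ((L : ℝ) ^ k * b) ≤ 1 := by rw [← ht_def]; nlinarith
  -- (162) in the shape `c · α₁ · (L^{j+1}η)` of `ineq163_explicit`, `c = 16d`, `α₁ = t`, `L^{j+1}η = L^{j+1}/L^k`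
  have hstep : ∀ j < k, ‖(frameFacG L U₀ U₁ k z j : 𝔸) - 1‖ ≤ 16 * d * t * ((L : ℝ) ^ (j + 1) / (L : ℝ) ^ k) := by
    intro j hj
    calc _ ≤ 16 * d * ((L : ℝ) ^ (j + 1) * b) := (ineq162_general hL1 hb hV Q hQ hQb hsm hj _).2.1
      _ = 16 * d * t * ((L : ℝ) ^ (j + 1) / (L : ℝ) ^ k) := by rw [ht_def]; field_simp
  have h163 := ineq163_explicit (fun j => (frameFacG L U₀ U₁ k z j : 𝔸)) k (L : ℝ) (16 * d) t hLr
    (by positivity) ht0 hstep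
  have h32 : 2 * (16 * (d : ℝ)) * t = 32 * d * t := by ring
  rw [h32, ← val_vcov_eq_oprod] at h163
  obtain ⟨h1, h2⟩ := h163
  -- `exp(x) − 1 ≤ 2x` for `0 ≤ x ≤ 1`
  have hx1 : 32 * (d : ℝ) * t ≤ 1 := by nlinarith
  have hx0 : 0 ≤ 32 * (d : ℝ) * t := by positivity
  have hexp : Real.exp (32 * d * t) - 1 ≤ 2 * (32 * d * t) := by
    have h := Real.abs_exp_sub_one_le (x := 32 * d * t) (by rw [abs_of_nonneg hx0]; exact hx1)
    rw [abs_of_nonneg hx0] at h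
    exact (le_abs_self _).trans h
  have h3 : ‖(vcov L U₀ U₁ k z : 𝔸) - 1‖ ≤ 64 * d * t := by linarith
  refine ⟨h1, h2, h3, ?_⟩
  have hhalf : ‖(vcov L U₀ U₁ k z : 𝔸) - 1‖ ≤ 1 / 2 := by nlinarith
  calc _ ≤ 2 * ‖(vcov L U₀ U₁ k z : 𝔸) - 1‖ := norm_units_inv_sub_one_le _ hhalf
    _ ≤ 2 * (64 * d * t) := by linarith
    _ = 128 * d * t := by ring

/-! ## §4 Proposition 6 (159) & (164) at a general background -/

/-- **PROPOSITION 6 OF B7, (164), AT A GENERAL BACKGROUND — EXPLICIT constant, UNIFORM IN `k`** (p. 43: "Moreover, we have a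
bound `|\overline{U′U₀}ᵏ(Ūᵏ₀)⁻¹ − 1| < O(1)α₁`. (164) Of course, we assume that `α₀, α₁` are sufficiently small.").  HYPOTHESES:
`L ≥ 2`; the averaged backgrounds `Ū₀ʲ = avgIter L U₀ j`, `j ≤ k`, with values in `U1` (from (52): `prop6_general_of52`); (161) in
exp-form: `U̿′ʲ = dbavgCovIter L U₀ U₁ j = e^{Q_j}` with `‖Q_j‖ ≤ 2Lʲb`, `j ≤ k`; the single threshold `8C₁(d)·Lᵏb ≤ 1` (`Lᵏb` plays
`α₁`).  THEN at every bond `c = ⟨z, z + e_κ⟩` of `Ω^{(k)} ≅ ℤᵈ`: **(159)** `Ūᵏ(c)(Ū₀ᵏ(c))⁻¹ = v_k(z)·exp(Q_k(c))·R(Ū₀ᵏ(c))(v_k(z +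
e_κ)⁻¹)` (`Ūᵏ = avgIter L (U₁U₀) k`, `v_k = vcov L U₀ U₁ k`, `R(X)Y = XYX⁻¹`; from `B7Eq92Concrete.val_avgIter_mul_eq`), (161)
`‖Q_k(c)‖ ≤ 2Lᵏb`, (163) `‖v_k(z) − 1‖ ≤ 64d·Lᵏb`, `‖v_k(z + e_κ)⁻¹ − 1‖ ≤ 128d·Lᵏb`, and **(164) `‖Ūᵏ(c)(Ū₀ᵏ(c))⁻¹ − 1‖ ≤
200(d+1)·Lᵏb`** — the printed `O(1)` witnessed by `200(d+1)`, independent of `k`, `L`, `b` (the rotation `R(Ū₀ᵏ(c))` by a `U1`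
element does not increase `‖· − 1‖`; arithmetic `B7Prop6Flat.arith164`).  At `U₀ = 1`: `B7Prop6Flat.prop6_flat`.
[cite: Balaban1985Averaging, Prop. 6 (164) p.43, (159)–(163) p.42] -/
theorem prop6_general {L : ℕ} (hL : 2 ≤ L) {U₀ U₁ : Site d → Fin d → 𝔸ˣ} {k : ℕ} {b : ℝ} (hb : 0 ≤ b)
    (hV : ∀ j ≤ k, ∀ (x : Site d) (κ : Fin d), avgIter L U₀ j x κ ∈ U1 𝔸)
    (Q : ℕ → Site d → Fin d → 𝔸) (hQ : ∀ j ≤ k, dbavgCovIter L U₀ U₁ j = expCfg (Q j))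
    (hQb : ∀ j ≤ k, ∀ (z : Site d) (κ : Fin d), ‖Q j z κ‖ ≤ 2 * ((L : ℝ) ^ j * b))
    (hk : 8 * C1 d * ((L : ℝ) ^ k * b) ≤ 1) (z : Site d) (κ : Fin d) :
    ((avgIter L (U₁ * U₀) k z κ : 𝔸ˣ) : 𝔸) * (((avgIter L U₀ k z κ)⁻¹ : 𝔸ˣ) : 𝔸)
        = (vcov L U₀ U₁ k z : 𝔸) * exp (Q k z κ) *
            ((avgIter L U₀ k z κ : 𝔸) * (((vcov L U₀ U₁ k (z + e κ))⁻¹ : 𝔸ˣ) : 𝔸) * (((avgIter L U₀ k z κ)⁻¹ : 𝔸ˣ) : 𝔸)) ∧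
      ‖Q k z κ‖ ≤ 2 * ((L : ℝ) ^ k * b) ∧
      ‖(vcov L U₀ U₁ k z : 𝔸) - 1‖ ≤ 64 * d * ((L : ℝ) ^ k * b) ∧
      ‖(((vcov L U₀ U₁ k (z + e κ))⁻¹ : 𝔸ˣ) : 𝔸) - 1‖ ≤ 128 * d * ((L : ℝ) ^ k * b) ∧
      ‖((avgIter L (U₁ * U₀) k z κ : 𝔸ˣ) : 𝔸) * (((avgIter L U₀ k z κ)⁻¹ : 𝔸ˣ) : 𝔸) - 1‖
        ≤ 200 * ((d : ℝ) + 1) * ((L : ℝ) ^ k * b) := by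
  have hd0 : (0 : ℝ) ≤ d := Nat.cast_nonneg d
  set t : ℝ := (L : ℝ) ^ k * b with ht_def
  have ht0 : 0 ≤ t := by positivity
  have hsmall := small_of_threshold (d := d) ht0 hk
  have hX : ((dbavgCovIter L U₀ U₁ k z κ : 𝔸ˣ) : 𝔸) = exp (Q k z κ) := by rw [hQ k le_rfl]; rfl
  have hid : ((avgIter L (U₁ * U₀) k z κ : 𝔸ˣ) : 𝔸) * (((avgIter L U₀ k z κ)⁻¹ : 𝔸ˣ) : 𝔸)
      = (vcov L U₀ U₁ k z : 𝔸) * exp (Q k z κ) *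
          ((avgIter L U₀ k z κ : 𝔸) * (((vcov L U₀ U₁ k (z + e κ))⁻¹ : 𝔸ˣ) : 𝔸) * (((avgIter L U₀ k z κ)⁻¹ : 𝔸ˣ) : 𝔸)) := by
    rw [val_avgIter_mul_eq, hX]
    simp only [mul_assoc]
  have hv := (ineq163_general hL hb hV Q hQ hQb hk z).2.2.1
  have hvi := (ineq163_general hL hb hV Q hQ hQb hk (z + e κ)).2.2.2
  refine ⟨hid, hQb k le_rfl z κ, hv, hvi, ?_⟩
  -- the middle factor: ‖exp Q − 1‖ ≤ e^{2t} − 1 ≤ 4t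
  have h2t1 : 2 * t ≤ 1 := by nlinarith
  have hU : ‖exp (Q k z κ) - 1‖ ≤ 4 * t := by
    have h := (norm_exp_sub_one_le_of_norm_le (hQb k le_rfl z κ)).1
    have he : Real.exp (2 * t) - 1 ≤ 2 * (2 * t) := by
      have h' := Real.abs_exp_sub_one_le (x := 2 * t) (by rw [abs_of_nonneg (by positivity)]; exact h2t1)
      rw [abs_of_nonneg (by positivity : (0 : ℝ) ≤ 2 * t)] at h'
      exact (le_abs_self _).trans h'
    linarith
  -- the rotated inverse frame: `‖R(Ū₀ᵏ(c))(v_k(c₊)⁻¹) − 1‖ ≤ ‖v_k(c₊)⁻¹ − 1‖`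
  have hW : ‖(avgIter L U₀ k z κ : 𝔸) * (((vcov L U₀ U₁ k (z + e κ))⁻¹ : 𝔸ˣ) : 𝔸) * (((avgIter L U₀ k z κ)⁻¹ : 𝔸ˣ) : 𝔸)
      - 1‖ ≤ 128 * d * t :=
    (norm_units_conj_sub_one_le (hV k le_rfl z κ) _).trans hvi
  rw [hid]
  calc _ ≤ (1 + ‖(vcov L U₀ U₁ k z : 𝔸) - 1‖) * (1 + ‖exp (Q k z κ) - 1‖)
          * (1 + ‖(avgIter L U₀ k z κ : 𝔸) * (((vcov L U₀ U₁ k (z + e κ))⁻¹ : 𝔸ˣ) : 𝔸)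
              * (((avgIter L U₀ k z κ)⁻¹ : 𝔸ˣ) : 𝔸) - 1‖) - 1 := norm_mul_mul_sub_one_le _ _ _
    _ ≤ 200 * ((d : ℝ) + 1) * t :=
        arith164 hd0 ht0 hsmall (norm_nonneg _) (norm_nonneg _) (norm_nonneg _) hv hU hW

/-- **(164) AT A GENERAL BACKGROUND UNDER (52)** — `prop6_general` with the `U1` level hypothesis DISCHARGED: for `U₀` with values
in an average-closed subgroup `G ⊂ U1` (`B7Prop2Explicit.AvgClosed`, e.g. the unitary group) satisfying (52) `sup_p‖U₀(∂p) − 1‖ <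
α₀L^{−2k}` with Prop. 2's smallness `C₀α₀ ≤ ⅓`, `2α₀ ≤ c′₂` (then every `Ū₀ʲ`, `j ≤ k`, is `G`-valued: `B7Prop2Explicit.avgIter_mem`),
and `U̿′ʲ = e^{Q_j}` with (161) `‖Q_j‖ ≤ 2Lʲb` (`j ≤ k`), `8C₁(d)Lᵏb ≤ 1`: `‖Ūᵏ(c)(Ū₀ᵏ(c))⁻¹ − 1‖ ≤ 200(d+1)·Lᵏb` at every bond of
`Ω^{(k)}` (print: "If `U₀` satisfies (52), then … `|\overline{U′U₀}ᵏ(Ūᵏ₀)⁻¹ − 1| < O(1)α₁`. (164)").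
[cite: Balaban1985Averaging, Prop. 6 (164) p.43, (52) p.26, (161) p.42] -/
theorem prop6_general_of52 {L : ℕ} (hL : 2 ≤ L) {G : Subgroup 𝔸ˣ} (hG : AvgClosed d L G) {U₀ : Site d → Fin d → 𝔸ˣ}
    (hU : ∀ x κ, U₀ x κ ∈ G) (k : ℕ) {α₀ : ℝ} (hα : 0 < α₀) (hα3 : C0 d * α₀ ≤ 1 / 3) (hα2 : 2 * α₀ ≤ c2' d L)
    (h52 : pdev U₀ < α₀ * (((L : ℝ) ^ k)⁻¹) ^ 2) {U₁ : Site d → Fin d → 𝔸ˣ} {b : ℝ} (hb : 0 ≤ b)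
    (Q : ℕ → Site d → Fin d → 𝔸) (hQ : ∀ j ≤ k, dbavgCovIter L U₀ U₁ j = expCfg (Q j))
    (hQb : ∀ j ≤ k, ∀ (z : Site d) (κ : Fin d), ‖Q j z κ‖ ≤ 2 * ((L : ℝ) ^ j * b))
    (hk : 8 * C1 d * ((L : ℝ) ^ k * b) ≤ 1) (z : Site d) (κ : Fin d) :
    ‖((avgIter L (U₁ * U₀) k z κ : 𝔸ˣ) : 𝔸) * (((avgIter L U₀ k z κ)⁻¹ : 𝔸ˣ) : 𝔸) - 1‖
      ≤ 200 * ((d : ℝ) + 1) * ((L : ℝ) ^ k * b) := by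
  have hV : ∀ j ≤ k, ∀ (x : Site d) (κ : Fin d), avgIter L U₀ j x κ ∈ U1 𝔸 :=
    fun j hj x κ => hG.le_U1 (avgIter_mem L hL hG k U₀ hU hα hα3 hα2 h52 j hj x κ)
  exact (prop6_general hL hb hV Q hQ hQb hk z κ).2.2.2.2

end Literature.MathematicalPhysics.QuantumFieldTheory.Balaban1983to89.B7Prop6General
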